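import Mathlib
import HarnessLib

/-!
# Monotone blending of an increasing function with the identity near a common zero
# (the logarithmic partition of unity)

General real analysis, infrastructure for the fact seat of
`Literature.Topology.FourManifolds.BudneyGabai2019_thm_3_13` (`NonSeparatingSpheres.lean`;
R. Budney, D. Gabai, *Knotted 3-balls in `S⁴`*, arXiv:1912.09029, Thm. 3.13).  In the classical
argument for `n ≤ 2` (cut `S¹ × Sⁿ` open along the non-separating sphere `K`, straighten the two
boundary spheres of the cut-open cyclic cover, reglue) one has to produce, out of the naive height
`t` on a fundamental domain, a smooth *equivariant* function without critical points: below the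
seam the height reads `F (t, y)` (the height transported by the deck transformation), above it
reads `t`; both vanish on the seam `t = 0` and increase in `t`, but with different normal
derivatives.  A partition of unity `h = F + Λ(t/δ) (t - F)` is increasing in `t` only if the
transition of `Λ` is slow *relative to* `t`, uniformly in the ratio of the two normal
derivatives.  This file provides such a profile — a smooth transition in the variable `log t`,
`Λ(u) = S(1 + log u / L)` with Mathlib's `Real.smoothTransition = S` — and proves the resulting
one-variable estimate:

* `LogBlend.exists_deriv_smoothTransition_bound` — `|S'| ≤ C` on `ℝ` for some `C ≥ 0`;
* `LogBlend.exists_profile` — for `L > 0` the profile `Λ_L`: `C^∞` on `ℝ`, `= 0` on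
  `(-∞, e^{-L}]`, `= 1` on `[1, ∞)`, values in `[0, 1]`, and `|Λ_L'(u)| ≤ C / (L u)` for `u > 0`;
* `LogBlend.exists_blend` (**the blending lemma**): if `F (·, y)` (`y` in any index set) vanish
  at `0` and have derivatives in `[m, M]`, `m > 0`, on `|t| ≤ δ₀`, then for suitable
  `0 < δ₁ < δ ≤ δ₀` and a profile `Λ` with `Λ = 0` on `(-∞, δ₁/δ]`, `Λ = 1` on `[1, ∞)`, every
  blend `s ↦ F (s, y) + Λ (s/δ) (s - F (s, y))` has positive derivative at each `0 < t ≤ δ`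
  (indeed `≥ min (m, 1) / 2`): `h' = (1 - Λ) F' + Λ + (t - F) Λ'(t/δ)/δ`, where the last term is
  at most `(1 + M) C / L` in absolute value because `|t - F| ≤ (1 + M) t` and
  `|Λ'(t/δ)| ≤ C δ / (L t)` — small for `L` large, *whatever the size of `M`*.

Everything here is proved; no definition and no named fact is introduced (the profile is an
explicit expression inside the proofs and is exported existentially).

## References

* R. Budney, D. Gabai, *Knotted 3-balls in `S⁴`*, arXiv:1912.09029 (v2), §3, Thm. 3.13.
  [BudneyGabai2019]
* M. W. Hirsch, *Differential Topology*, GTM 33 (1976), Ch. 2 §2 (smooth partitions of unity and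
  bump functions). [HirschDT1976]
-/

noncomputable section

open Set Filter Real
open scoped Topology ContDiff

namespace Literature.Topology.FourManifolds

namespace LogBlend

/-- **The derivative of Mathlib's smooth transition is bounded**: `|S'(x)| ≤ C` for all `x`
(it is continuous and vanishes off `[0, 1]`). [folklore] -/
theorem exists_deriv_smoothTransition_bound :
    ∃ C : ℝ, 0 ≤ C ∧ ∀ x : ℝ, |deriv smoothTransition x| ≤ C := by
  have hcont : Continuous (deriv smoothTransition) :=
    (smoothTransition.contDiff (n := 1)).continuous_deriv le_rfl
  obtain ⟨C, hC⟩ := isCompact_Icc.exists_bound_of_continuousOn (s := Icc (0 : ℝ) 1)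
    hcont.continuousOn
  refine ⟨max C 0, le_max_right _ _, fun x ↦ ?_⟩
  by_cases hx : x ∈ Icc (0 : ℝ) 1
  · exact (le_of_eq (Real.norm_eq_abs _).symm).trans ((hC x hx).trans (le_max_left _ _))
  · -- off `[0, 1]` the function is locally constant
    have hderiv : deriv smoothTransition x = 0 := by
      rw [mem_Icc, not_and_or, not_le, not_le] at hx
      rcases hx with hx | hx
      · have h : smoothTransition =ᶠ[𝓝 x] fun _ ↦ (0 : ℝ) := by
          filter_upwards [Iio_mem_nhds hx] with y hy
          exact smoothTransition.zero_of_nonpos (le_of_lt hy)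
        rw [h.deriv_eq, deriv_const]
      · have h : smoothTransition =ᶠ[𝓝 x] fun _ ↦ (1 : ℝ) := by
          filter_upwards [Ioi_mem_nhds hx] with y hy
          exact smoothTransition.one_of_one_le (le_of_lt hy)
        rw [h.deriv_eq, deriv_const]
    rw [hderiv, abs_zero]
    exact le_max_right _ _

/-- **The logarithmic profile.**  For `L > 0` there is a `C^∞` function `Λ : ℝ → ℝ` with
`Λ = 0` on `(-∞, e^{-L}]`, `Λ = 1` on `[1, ∞)`, `0 ≤ Λ ≤ 1`, and `|Λ'(u)| ≤ C / (L u)` for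
`u > 0`, where `C` bounds `|S'|` — namely `Λ(u) = S(1 + log u / L)` for `u > 0` (and `0` for
`u ≤ 0`): the transition happens on the logarithmic scale, between `u = e^{-L}` and `u = 1`, so
`u Λ'(u) = S'(·)/L` is uniformly small. [folklore] -/
theorem exists_profile {C : ℝ} (hC : ∀ x : ℝ, |deriv smoothTransition x| ≤ C) {L : ℝ}
    (hL : 0 < L) :
    ∃ Λ : ℝ → ℝ, ContDiff ℝ ∞ Λ ∧ (∀ u, u ≤ exp (-L) → Λ u = 0) ∧ (∀ u, 1 ≤ u → Λ u = 1) ∧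
      (∀ u, 0 ≤ Λ u ∧ Λ u ≤ 1) ∧
      ∀ u, 0 < u → ∃ d, HasDerivAt Λ d u ∧ |d| ≤ C / (L * u) := by
  set g : ℝ → ℝ := fun u ↦ smoothTransition (1 + log u / L) with hg
  set Λ : ℝ → ℝ := fun u ↦ if u ≤ 0 then 0 else g u with hΛ
  have hΛpos : ∀ u, 0 < u → Λ u = g u := fun u hu ↦ by simp [hΛ, not_le.2 hu]
  -- `Λ = 0` on `(-∞, e^{-L}]`
  have hΛ0 : ∀ u, u ≤ exp (-L) → Λ u = 0 := by
    intro u hu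
    by_cases hu0 : u ≤ 0
    · simp [hΛ, hu0]
    · rw [hΛpos u (not_le.1 hu0), hg]
      apply smoothTransition.zero_of_nonpos
      have h1 : log u ≤ -L := by
        rw [← log_exp (-L)]
        exact log_le_log (not_le.1 hu0) hu
      have h2 : log u / L ≤ -1 := by
        rw [div_le_iff₀ hL]
        linarith
      linarith
  -- the smooth formula for `u > 0`
  have hgs : ∀ u, 0 < u → ContDiffAt ℝ ∞ g u := fun u hu ↦
    smoothTransition.contDiffAt.comp u
      (contDiffAt_const.add ((contDiffAt_log.2 hu.ne').div_const L))
  have hgd : ∀ u, 0 < u → HasDerivAt g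
      (deriv smoothTransition (1 + log u / L) * (u⁻¹ / L)) u := by
    intro u hu
    have h1 : HasDerivAt (fun v ↦ 1 + log v / L) (u⁻¹ / L) u := by
      simpa using ((hasDerivAt_log hu.ne').div_const L).const_add 1
    exact ((smoothTransition.contDiffAt (n := 1)).differentiableAt (by simp)).hasDerivAt.comp u h1
  refine ⟨Λ, ?_, hΛ0, fun u hu ↦ ?_, fun u ↦ ?_, fun u hu ↦ ?_⟩
  · -- smoothness: near `u ≤ 0`... precisely on `(-∞, e^{-L})` the function vanishes, on
    -- `(0, ∞)` it is the smooth formula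
    refine contDiff_iff_contDiffAt.2 fun u ↦ ?_
    by_cases hu : u < exp (-L)
    · have h : Λ =ᶠ[𝓝 u] fun _ ↦ (0 : ℝ) := by
        filter_upwards [Iio_mem_nhds hu] with v hv
        exact hΛ0 v hv.le
      exact contDiffAt_const.congr_of_eventuallyEq h
    · have hu0 : 0 < u := (exp_pos _).trans_le (not_lt.1 hu)
      have h : Λ =ᶠ[𝓝 u] g := by
        filter_upwards [Ioi_mem_nhds hu0] with v hv
        exact hΛpos v hv
      exact (hgs u hu0).congr_of_eventuallyEq h
  · rw [hΛpos u (by linarith), hg]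
    apply smoothTransition.one_of_one_le
    have : 0 ≤ log u / L := div_nonneg (log_nonneg hu) hL.le
    linarith
  · by_cases hu : u ≤ 0
    · simp [hΛ, hu]
    · rw [hΛpos u (not_le.1 hu), hg]
      exact ⟨smoothTransition.nonneg _, smoothTransition.le_one _⟩
  · refine ⟨deriv smoothTransition (1 + log u / L) * (u⁻¹ / L), ?_, ?_⟩
    · have h : Λ =ᶠ[𝓝 u] g := by
        filter_upwards [Ioi_mem_nhds hu] with v hv
        exact hΛpos v hv
      exact (hgd u hu).congr_of_eventuallyEq h
    · rw [abs_mul, abs_of_pos (by positivity : 0 < u⁻¹ / L)]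
      calc |deriv smoothTransition (1 + log u / L)| * (u⁻¹ / L)
          ≤ C * (u⁻¹ / L) := by gcongr; exact hC _
        _ = C / (L * u) := by field_simp

/-- **The blending lemma.**  Let `F, F' : ℝ → Y → ℝ` with `F 0 y = 0`, `HasDerivAt (F · y)
(F' t y) t` and `m ≤ F' t y ≤ M` for `|t| ≤ δ₀` (all `y`), where `0 < m`, `0 < δ₀`.  Then there
are `0 < δ₁ < δ ≤ δ₀` and a `C^∞` profile `Λ` with `Λ = 0` on `(-∞, δ₁/δ]`, `Λ = 1` on `[1, ∞)`,
`0 ≤ Λ ≤ 1`, such that for every `y` and every `0 < t ≤ δ` the blend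
`s ↦ F s y + Λ (s/δ) (s - F s y)` has derivative `≥ min m 1 / 2 > 0` at `t`.  (So the blend
equals `F (·, y)` on `(-∞, δ₁]`, the identity on `[δ, ∞)`, and is strictly increasing on
`[-δ₀, δ]`.) [folklore] -/
theorem exists_blend {Y : Type*} {F F' : ℝ → Y → ℝ} {δ₀ m M : ℝ} (hδ₀ : 0 < δ₀) (hm : 0 < m)
    (hF0 : ∀ y, F 0 y = 0) (hderiv : ∀ t y, |t| ≤ δ₀ → HasDerivAt (F · y) (F' t y) t)
    (hm' : ∀ t y, |t| ≤ δ₀ → m ≤ F' t y) (hM : ∀ t y, |t| ≤ δ₀ → F' t y ≤ M) :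
    ∃ (Λ : ℝ → ℝ) (δ δ₁ : ℝ), ContDiff ℝ ∞ Λ ∧ 0 < δ₁ ∧ δ₁ < δ ∧ δ ≤ δ₀ ∧
      (∀ u, u ≤ δ₁ / δ → Λ u = 0) ∧ (∀ u, 1 ≤ u → Λ u = 1) ∧ (∀ u, 0 ≤ Λ u ∧ Λ u ≤ 1) ∧
      ∀ y t, 0 < t → t ≤ δ →
        ∃ d, min m 1 / 2 ≤ d ∧ HasDerivAt (fun s ↦ F s y + Λ (s / δ) * (s - F s y)) d t := by
  obtain ⟨C, hC0, hC⟩ := exists_deriv_smoothTransition_bound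
  set μ : ℝ := min m 1 with hμ
  have hμ0 : 0 < μ := lt_min hm one_pos
  set L : ℝ := 2 * (1 + |M|) * C / μ + 1 with hL
  have hL0 : 0 < L := by positivity
  have hkey : (1 + |M|) * C / L ≤ μ / 2 := by
    rw [div_le_iff₀ hL0, hL]
    have h1 : μ / 2 * (2 * (1 + |M|) * C / μ + 1) = (1 + |M|) * C + μ / 2 := by
      field_simp
    rw [h1]
    linarith
  obtain ⟨Λ, hΛs, hΛ0, hΛ1, hΛ01, hΛd⟩ := exists_profile hC hL0
  refine ⟨Λ, δ₀, δ₀ * exp (-L), hΛs, by positivity, ?_, le_rfl,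
    fun u hu ↦ hΛ0 u (by rwa [mul_div_cancel_left₀ _ hδ₀.ne'] at hu), hΛ1, hΛ01,
    fun y t ht htδ ↦ ?_⟩
  · have h1 : exp (-L) < 1 := exp_lt_one_iff.mpr (by linarith)
    nlinarith
  · have htabs : |t| ≤ δ₀ := by rwa [abs_of_pos ht]
    have habs : ∀ s ∈ Icc 0 t, |s| ≤ δ₀ := fun s hs ↦ by
      rw [abs_of_nonneg hs.1]
      exact hs.2.trans htδ
    -- mean value theorem: `F t y = F' ξ y · t`
    obtain ⟨ξ, hξ, hξeq⟩ := exists_hasDerivAt_eq_slope (F · y) (F' · y) ht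
      (fun s hs ↦ (hderiv s y (habs s hs)).continuousAt.continuousWithinAt)
      (fun s hs ↦ hderiv s y (habs s (Ioo_subset_Icc_self hs)))
    have hξabs : |ξ| ≤ δ₀ := habs ξ (Ioo_subset_Icc_self hξ)
    have hFt : F t y = F' ξ y * t := by
      simp only [hF0, sub_zero] at hξeq
      field_simp at hξeq
      linarith
    have hmt : m * t ≤ F t y := by
      rw [hFt]
      exact mul_le_mul_of_nonneg_right (hm' ξ y hξabs) ht.le
    have hMt : F t y ≤ M * t := by
      rw [hFt]
      exact mul_le_mul_of_nonneg_right (hM ξ y hξabs) ht.le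
    -- the derivative of the blend at `t`
    obtain ⟨d, hdΛ, hdbound⟩ := hΛd (t / δ₀) (by positivity)
    have hΛcomp : HasDerivAt (fun s ↦ Λ (s / δ₀)) (d * (1 / δ₀)) t :=
      hdΛ.comp t ((hasDerivAt_id t).div_const δ₀)
    have hblend : HasDerivAt (fun s ↦ F s y + Λ (s / δ₀) * (s - F s y))
        (F' t y + (d * (1 / δ₀) * (t - F t y) + Λ (t / δ₀) * (1 - F' t y))) t :=
      (hderiv t y htabs).add (hΛcomp.mul ((hasDerivAt_id t).sub (hderiv t y htabs)))
    refine ⟨_, ?_, hblend⟩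
    -- ### the estimate
    set X : ℝ := d * (1 / δ₀) * (t - F t y) with hX
    have h1 : |X| ≤ (1 + |M|) * C / L := by
      rw [hX, abs_mul]
      have ha : |d * (1 / δ₀)| ≤ C / (L * (t / δ₀)) * (1 / δ₀) := by
        rw [abs_mul, abs_of_pos (by positivity : (0 : ℝ) < 1 / δ₀)]
        exact mul_le_mul_of_nonneg_right hdbound (by positivity)
      have hb : |t - F t y| ≤ (1 + |M|) * t := by
        rw [abs_le]
        constructor <;> nlinarith [hmt, hMt, le_abs_self M, ht, hm]
      calc |d * (1 / δ₀)| * |t - F t y|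
          ≤ (C / (L * (t / δ₀)) * (1 / δ₀)) * ((1 + |M|) * t) :=
            mul_le_mul ha hb (abs_nonneg _) (by positivity)
        _ = (1 + |M|) * C / L := by field_simp
    have h2 : μ ≤ (1 - Λ (t / δ₀)) * F' t y + Λ (t / δ₀) := by
      obtain ⟨hl0, hl1⟩ := hΛ01 (t / δ₀)
      have hF' := hm' t y htabs
      have hμm : μ ≤ m := min_le_left _ _
      have hμ1 : μ ≤ 1 := min_le_right _ _
      nlinarith
    have h3 : -|X| ≤ X := neg_abs_le X
    have h4 : F' t y + (d * (1 / δ₀) * (t - F t y) + Λ (t / δ₀) * (1 - F' t y)) =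
        ((1 - Λ (t / δ₀)) * F' t y + Λ (t / δ₀)) + X := by
      rw [hX]; ring
    rw [h4]
    linarith

end LogBlend

end Literature.Topology.FourManifolds

end
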